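import Literature.Barriers.PneNP.NPHardnessToOneWayFunctionsInstance
import Literature.Barriers.PneNP.NPHardnessToOneWayFunctionsAnalysis
import Mathlib.Analysis.SpecialFunctions.Log.Base
import HarnessLib

/-!
# Barrier `NPHardnessToOneWayFunctions` (AGGM 2006, Thm. 4): the concrete game's constants

App. D campaign (design v3), bridge part B4a-ii, of the discharge of
`Literature.Barriers.PneNP.AkaviaEtAl2006_complMemAM`.

Bookkeeping for the adequacy step: how the abstract quantities of the analysis (`εS`, `εC`, `KS`,
`ρ`, `εA` of the four tests, `|C|`, `log₂(|C| F)`, the number of non-planted pool types) read on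
the concrete game `theSetup` of `…Instance.lean`. All `rfl` or one-line; no named facts.

## References

* [AkaviaEtAl2006] A. Akavia, O. Goldreich, S. Goldwasser, D. Moshkovitz, *On basing one-way
  functions on NP-hardness*, STOC 2006; preprint App. D (printed pp. 21–22).
-/

noncomputable section

namespace Literature.Barriers.PneNP

open Finset Literature.Computability.Complexity Literature.Computability.Cryptography

open scoped Classical

namespace AppD

section Facts

variable (R : OracleAdversary Bool) (f : List Bool → List Bool) (w : List Bool) (hq : R.QueriesOfInputLength)
  (F : ℕ) (hFle : R.fuel.eval w.length ≤ F) (hF : 0 < F) (I : IParams w.length (R.coins.eval w.length) F)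

/-- The protocol parameters of the concrete game. [folklore] -/
@[simp] theorem theSetup_prm : (theSetup R f w hq F hFle hF I).prm = I.prm := rfl

/-- Lower-bound test on occurrence claims: soundness error `64/u`. [folklore] -/
@[simp] theorem theSetup_GC_εS : (theSetup R f w hq F hFle hF I).GC.εS = 64 / I.u := rfl
/-- Lower-bound test on preimage claims: soundness error `64/u`. [folklore] -/
@[simp] theorem theSetup_GS_εS : (theSetup R f w hq F hFle hF I).GS.εS = 64 / I.u := rfl
/-- Lower-bound test on occurrence claims: completeness error `64/u`. [folklore] -/
@[simp] theorem theSetup_GC_εC : (theSetup R f w hq F hFle hF I).GC.εC = 64 / I.u := rfl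
/-- Lower-bound test on preimage claims: completeness error `64/u`. [folklore] -/
@[simp] theorem theSetup_GS_εC : (theSetup R f w hq F hFle hF I).GS.εC = 64 / I.u := rfl
/-- Secret test on planted occurrence sets: slack `(1+β_C)³`. [folklore] -/
@[simp] theorem theSetup_AC_KS : (theSetup R f w hq F hFle hF I).AC.KS = (1 + I.βC) ^ 3 := rfl
/-- Secret test on decoy preimage sets: slack `(1+β_S)³`. [folklore] -/
@[simp] theorem theSetup_AS_KS : (theSetup R f w hq F hFle hF I).AS.KS = (1 + I.βS) ^ 3 := rfl
/-- Secret test on planted occurrence sets: detection rate. [folklore] -/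
@[simp] theorem theSetup_AC_ρ : (theSetup R f w hq F hFle hF I).AC.ρ =
    I.βC * (1 - 32 / (I.βC ^ 2 * (1 + I.βC) * (2 : ℝ) ^ I.b₀)) / (1 + I.βC) := rfl
/-- Secret test on decoy preimage sets: detection rate. [folklore] -/
@[simp] theorem theSetup_AS_ρ : (theSetup R f w hq F hFle hF I).AS.ρ =
    I.βS * (1 - 32 / (I.βS ^ 2 * (1 + I.βS) * (2 : ℝ) ^ I.b₀)) / (1 + I.βS) := rfl
/-- Secret test on planted occurrence sets: false-rejection rate. [folklore] -/
@[simp] theorem theSetup_AC_εA : (theSetup R f w hq F hFle hF I).AC.εA = 2 / (I.βC ^ 2 * (2 : ℝ) ^ I.b₀) := rfl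
/-- Secret test on decoy preimage sets: false-rejection rate. [folklore] -/
@[simp] theorem theSetup_AS_εA : (theSetup R f w hq F hFle hF I).AS.εA = 2 / (I.βS ^ 2 * (2 : ℝ) ^ I.b₀) := rfl

/-- `log₂(|C| F) = coins + n + fbits` when `F = 2^{fbits}`. [folklore] -/
theorem logb_card_PC (fbits : ℕ) :
    Real.logb 2 (Fintype.card (PC R w) * (2 ^ fbits : ℕ)) = (R.coins.eval w.length + w.length + fbits : ℕ) := by
  rw [card_PC]
  push_cast
  rw [← pow_add, ← pow_add, Real.logb_pow, Real.logb_self_eq_one one_lt_two]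
  simp

/-- The non-planted pool types number `2^{bπ} - 1`. [folklore] -/
theorem card_ty_ne_ty0 {C : Type*} [Fintype C] {n : ℕ} (S : Setup C n) :
    ((univ.filter fun T : S.Ty => T ≠ S.ty0).card : ℝ) = (2 : ℝ) ^ S.prm.bπ - 1 := by
  rw [filter_ne' univ S.ty0, card_erase_of_mem (mem_univ _), card_univ, Fintype.card_fin]
  have : 1 ≤ 2 ^ S.prm.bπ := Nat.one_le_two_pow
  push_cast [Nat.cast_sub this]
  ring

end Facts

end AppD

end Literature.Barriers.PneNP

end
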